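import Summits.AtomisticToContinuum.BoseEinsteinCondensation.Theorems.BECSwapNoCatastropheDefs
import Summits.AtomisticToContinuum.BoseEinsteinCondensation.Theorems.BECSwapNoCatastropheTorusHalfSwapOverlapLowerFrame
import Literature.MathematicalPhysics.QuantumManyBody.PeriodicBoseGasImpurityTranslation
import Literature.MathematicalPhysics.QuantumManyBody.BoseGasProductState
import HarnessLib

/-!
# Crux `TorusHalfSwapOverlap` (stmt-AtomisticToContinuum-14393), line `birth`, stub `stub_upperFrameIntegrable` (S6b)

Route `BECSwapNoCatastrophe` (sub-problem `BoseEinsteinCondensation`), lead c6 (2026-08-17). THE UPPER FRAME of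
the half-swap chord — THE HALF-SWAP DEFECT COSTS AT MOST FIRST-ORDER PERTURBATION THEORY, UNIFORMLY IN `n`: for
every repulsive finite-range `v`, every `n` and every torus side `L > 0`, on the absolute admissible class `Adm0`
of the two-copy torus (folded `TwoCopyTorus` vocabulary of `Theorems/BECSwapNoCatastropheDefs.lean`)
`inf_{Adm0} E2(½) ≤ 2 · E₀^per(n+1, L) + n · L⁻³ · ∫_{ℝ³} v(|x|) dx` (vacuous when `∫ v = ∞`, `n ≥ 1`).

Proof (translation averaging). For a one-copy periodic trial state `Ψ` and `t ∈ ℝ³` let `Ψ_t = Ψ(· - t𝟙)`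
(`PeriodicTrialState.exists_translate`; same energy, `periodicEnergy_translate`). The product
`Θ_t (X, Y) = Ψ X · Ψ_t Y` is absolutely admissible with `E2(0)(Θ_t) = periodicEnergy v Ψ + periodicEnergy v Ψ_t`
(two-state version of the landed `ProductUpper`: product rule + Tonelli), and pointwise
`w_½ ≤ (V(X) + V(Y)) + ∑ⱼ ½ (v^per(y₀ - xⱼ) + v^per(x₀ - yⱼ))` (split both pair sums at the tags,
`periodicInteraction_succ`; `½ p ≤ p`), so `inf_{Adm0} E2(½) ≤ E2(½)(Θ_t) ≤ 2 · periodicEnergy v Ψ + Cross(t)` for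
EVERY `t`, `Cross(t) = ∫_{cell²} (∑ⱼ ½ (v^per(y₀ - xⱼ) + v^per(x₀ - yⱼ))) |Ψ X|² |Ψ(Y - t𝟙)|²`. Averaging over
`t ∈ [0,L)³`: shift the `Y`-integral by `t𝟙` (`lintegral_cellN_comp_add`, periodic integrand), Tonelli with the
`t`-integral innermost, `∫_{[0,L)³} v^per(c ± t) dt = ∫_{ℝ³} v` (`lintegral_cell_periodizedPotential_sub`, `v^per`
even) for each of the `2n` cross terms, and `∫|Ψ|² = 1` twice give `∫_{[0,L)³} Cross = n · ∫_{ℝ³} v`; integrating the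
pointwise-in-`t` bound over the cell (`|[0,L)³| = L³`) and dividing by `L³`, then taking the infimum over `Ψ`
(`ENNReal.mul_iInf_of_ne`, `ENNReal.iInf_add`), proves the claim. All in `ℝ≥0∞` (`⊤` allowed). [folklore]
-/

noncomputable section

open MeasureTheory Filter
open scoped ENNReal NNReal BigOperators ComplexConjugate

namespace Summit.AtomisticToContinuum.BoseEinsteinCondensation.Cruxes.TorusHalfSwapOverlap.Birth

open Literature.MathematicalPhysics.QuantumManyBody.BoseGas

/-! ### Helper lemmas (inside `namespace UpperFrameIntegrable … end UpperFrameIntegrable`) -/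

namespace UpperFrameIntegrable

open Summit.AtomisticToContinuum.BoseEinsteinCondensation.TwoCopyTorus
  (kinetic2 halfSwapWeight cell2 E2zero E2half E2half_eq Adm0)

variable {N : ℕ} {L : ℝ}

/-! #### Arithmetic in `ℝ≥0∞` (`ennnorm_mul_sq` of `BoseGasProductState`, `LowerFrame.inv_two_mul_add_self` reused) -/

/-- `½ (A + B + C + D) ≤ A + B + ½ (C + D)` in `ℝ≥0∞` (`½ p ≤ p`; `½ ⊤ = ⊤` included). [folklore] -/
theorem two_inv_mul_four_le (A B C D : ℝ≥0∞) :
    (2 : ℝ≥0∞)⁻¹ * (A + B + C + D) ≤ A + B + 2⁻¹ * (C + D) := by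
  rw [show A + B + C + D = (A + B) + (C + D) by ring, mul_add]
  exact add_le_add (mul_le_of_le_one_left' (ENNReal.inv_le_one.2 one_le_two)) le_rfl

/-! #### Two-state products `Ψ₁ ⊗ Ψ₂` (two-state version of `ProductUpper`) -/

/-- `Ψ₁ ⊗ Ψ₂ : (X, Y) ↦ Ψ₁ X · Ψ₂ Y` is `C¹`. [folklore] -/
theorem contDiff_prod₂ (Ψ₁ Ψ₂ : PeriodicTrialState N L) :
    ContDiff ℝ 1 fun Z : Config N × Config N => Ψ₁.ψ Z.1 * Ψ₂.ψ Z.2 :=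
  (Ψ₁.contDiff.comp contDiff_fst).mul (Ψ₂.contDiff.comp contDiff_snd)

/-- `Ψ₁ ⊗ Ψ₂` is `Lℤ³`-periodic in every particle of either copy. [folklore] -/
theorem periodic_prod₂ (Ψ₁ Ψ₂ : PeriodicTrialState N L) (Z : Config N × Config N) (i : Fin N)
    (k : Fin 3) :
    Ψ₁.ψ (Z.1 + Pi.single i (EuclideanSpace.single k L)) * Ψ₂.ψ Z.2 = Ψ₁.ψ Z.1 * Ψ₂.ψ Z.2 ∧
      Ψ₁.ψ Z.1 * Ψ₂.ψ (Z.2 + Pi.single i (EuclideanSpace.single k L)) = Ψ₁.ψ Z.1 * Ψ₂.ψ Z.2 := by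
  rw [Ψ₁.periodic, Ψ₂.periodic]
  exact ⟨rfl, rfl⟩

/-- `∫_{cell²} |Ψ₁ X|² |Ψ₂ Y|² = 1` (Tonelli, both states normalised). [folklore] -/
theorem lintegral_normSq_mul_normSq (Ψ₁ Ψ₂ : PeriodicTrialState N L) :
    ∫⁻ Z in cellN N L ×ˢ cellN N L, ((‖Ψ₁.ψ Z.1‖₊ : ℝ≥0∞)) ^ 2 * ((‖Ψ₂.ψ Z.2‖₊ : ℝ≥0∞)) ^ 2 = 1 := by
  rw [ProductLower.volume_restrict_cellN_prod,
    lintegral_prod_mul (measurable_normSq Ψ₁.contDiff.continuous).aemeasurable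
      (measurable_normSq Ψ₂.contDiff.continuous).aemeasurable, Ψ₁.norm_eq, Ψ₂.norm_eq, one_mul]

/-- Product rule, pointwise: the uncoupled two-copy energy density of `Ψ₁ ⊗ Ψ₂` at `(X, Y)` is
`e₁(X) |Ψ₂ Y|² + |Ψ₁ X|² e₂(Y)` with `eᵢ = |∇Ψᵢ|² + V^per |Ψᵢ|²`. [folklore] -/
theorem energyDensity_prod₂ (v : ℝ → ℝ≥0∞) (Ψ₁ Ψ₂ : PeriodicTrialState N L) (Z : Config N × Config N) :
    kineticDensity (fun X => Ψ₁.ψ X * Ψ₂.ψ Z.2) Z.1 + kineticDensity (fun Y => Ψ₁.ψ Z.1 * Ψ₂.ψ Y) Z.2 +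
        (periodicInteraction v L Z.1 + periodicInteraction v L Z.2) *
          ((‖Ψ₁.ψ Z.1 * Ψ₂.ψ Z.2‖₊ : ℝ≥0∞)) ^ 2 =
      (kineticDensity Ψ₁.ψ Z.1 + periodicInteraction v L Z.1 * ((‖Ψ₁.ψ Z.1‖₊ : ℝ≥0∞)) ^ 2) *
          ((‖Ψ₂.ψ Z.2‖₊ : ℝ≥0∞)) ^ 2 +
        ((‖Ψ₁.ψ Z.1‖₊ : ℝ≥0∞)) ^ 2 *
          (kineticDensity Ψ₂.ψ Z.2 + periodicInteraction v L Z.2 * ((‖Ψ₂.ψ Z.2‖₊ : ℝ≥0∞)) ^ 2) := by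
  have h1 : kineticDensity (fun X => Ψ₁.ψ X * Ψ₂.ψ Z.2) Z.1 =
      ((‖Ψ₂.ψ Z.2‖₊ : ℝ≥0∞)) ^ 2 * kineticDensity Ψ₁.ψ Z.1 := by
    rw [show (fun X => Ψ₁.ψ X * Ψ₂.ψ Z.2) = fun X => Ψ₂.ψ Z.2 * Ψ₁.ψ X from
      funext fun X => mul_comm _ _]
    exact kineticDensity_const_mul_complex (Ψ₂.ψ Z.2) Ψ₁.ψ Z.1
  rw [h1, kineticDensity_const_mul_complex (Ψ₁.ψ Z.1) Ψ₂.ψ Z.2, ennnorm_mul_sq]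
  ring

/-- **`E2(0)(Ψ₁ ⊗ Ψ₂) = periodicEnergy v Ψ₁ + periodicEnergy v Ψ₂`** (product rule + Tonelli on
`cellN ×ˢ cellN`, both states normalised). [folklore] -/
theorem energy_prod₂_eq {v : ℝ → ℝ≥0∞} (hv : Measurable v) (Ψ₁ Ψ₂ : PeriodicTrialState N L) :
    ∫⁻ Z in cellN N L ×ˢ cellN N L,
        (kineticDensity (fun X => Ψ₁.ψ X * Ψ₂.ψ Z.2) Z.1 +
            kineticDensity (fun Y => Ψ₁.ψ Z.1 * Ψ₂.ψ Y) Z.2 +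
          (periodicInteraction v L Z.1 + periodicInteraction v L Z.2) *
            ((‖Ψ₁.ψ Z.1 * Ψ₂.ψ Z.2‖₊ : ℝ≥0∞)) ^ 2) =
      periodicEnergy v Ψ₁ + periodicEnergy v Ψ₂ := by
  have key := ProductUpper.lintegral_prod_cross ((volume : Measure (Config N)).restrict (cellN N L))
    ((volume : Measure (Config N)).restrict (cellN N L)) (ProductUpper.measurable_energyDensity hv Ψ₁)
    (measurable_normSq Ψ₁.contDiff.continuous) (measurable_normSq Ψ₂.contDiff.continuous)
    (ProductUpper.measurable_energyDensity hv Ψ₂)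
  rw [Ψ₁.norm_eq, Ψ₂.norm_eq, mul_one, one_mul] at key
  rw [ProductLower.volume_restrict_cellN_prod]
  simp_rw [energyDensity_prod₂ v Ψ₁ Ψ₂]
  exact key

/-! #### The pointwise weight bound and `E2(½) ≤ E2(0) + cross terms` -/

variable {n : ℕ}

/-- **Pointwise weight bound**: the half-swapped weight is at most the uncoupled weight plus the
tagged cross terms, `w_½ (X, Y) ≤ (V(X) + V(Y)) + ∑ⱼ ½ (v^per(y₀ - xⱼ₊₁) + v^per(x₀ - yⱼ₊₁))`
(split both pair sums at the tags, `periodicInteraction_succ`; `½ p ≤ p`). [folklore] -/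
theorem halfSwapWeight_le (v : ℝ → ℝ≥0∞) (L : ℝ) (Z : Config (n + 1) × Config (n + 1)) :
    halfSwapWeight v n L Z ≤ (periodicInteraction v L Z.1 + periodicInteraction v L Z.2) +
      ∑ j : Fin n, (2 : ℝ≥0∞)⁻¹ * (periodizedPotential v L (Z.2 0 - Z.1 j.succ) +
        periodizedPotential v L (Z.1 0 - Z.2 j.succ)) := by
  rw [periodicInteraction_succ v L Z.1, periodicInteraction_succ v L Z.2]
  calc halfSwapWeight v n L Z
      ≤ periodicInteraction v L (Fin.tail Z.1) + periodicInteraction v L (Fin.tail Z.2) +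
        ∑ j : Fin n, (periodizedPotential v L (Z.1 0 - Z.1 j.succ) +
          periodizedPotential v L (Z.2 0 - Z.2 j.succ) + 2⁻¹ * (periodizedPotential v L (Z.2 0 - Z.1 j.succ) +
          periodizedPotential v L (Z.1 0 - Z.2 j.succ))) := by
        unfold halfSwapWeight
        gcongr with j _
        exact two_inv_mul_four_le _ _ _ _
    _ = _ := by
        simp only [Finset.sum_add_distrib,
          show ∀ X : Config (n + 1), Matrix.vecTail X = Fin.tail X from fun _ => rfl]
        ring

/-- The cross weight `Z ↦ ∑ⱼ ½ (v^per(y₀ - xⱼ₊₁) + v^per(x₀ - yⱼ₊₁))` is measurable. [folklore] -/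
theorem measurable_crossWeight {v : ℝ → ℝ≥0∞} (hv : Measurable v) (n : ℕ) (L : ℝ) :
    Measurable fun Z : Config (n + 1) × Config (n + 1) =>
      ∑ j : Fin n, (2 : ℝ≥0∞)⁻¹ * (periodizedPotential v L (Z.2 0 - Z.1 j.succ) +
        periodizedPotential v L (Z.1 0 - Z.2 j.succ)) := by
  refine Finset.measurable_sum _ fun j _ => Measurable.const_mul (Measurable.add ?_ ?_) _
  · exact (measurable_periodizedPotential hv L).comp
      (((measurable_pi_apply 0).comp measurable_snd).sub ((measurable_pi_apply j.succ).comp measurable_fst))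
  · exact (measurable_periodizedPotential hv L).comp
      (((measurable_pi_apply 0).comp measurable_fst).sub ((measurable_pi_apply j.succ).comp measurable_snd))

/-- **`E2(½)(Θ) ≤ E2(0)(Θ) + ∫_{cell²} (cross weight) |Θ|²`** for every continuous `Θ` (pointwise weight
bound, then split the integral; measurability of the cross part from that of `v`). [folklore] -/
theorem E2half_le_E2zero_add {v : ℝ → ℝ≥0∞} (hv : Measurable v) (L : ℝ)
    {Θ : Config (n + 1) × Config (n + 1) → ℂ} (hΘ : Continuous Θ) :
    E2half v n L Θ ≤ E2zero v n L Θ + ∫⁻ Z in cell2 n L,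
      (∑ j : Fin n, (2 : ℝ≥0∞)⁻¹ * (periodizedPotential v L (Z.2 0 - Z.1 j.succ) +
        periodizedPotential v L (Z.1 0 - Z.2 j.succ))) * ((‖Θ Z‖₊ : ℝ≥0∞)) ^ 2 := by
  rw [E2half_eq]
  calc ∫⁻ Z in cell2 n L, kinetic2 n Θ Z + halfSwapWeight v n L Z * ((‖Θ Z‖₊ : ℝ≥0∞)) ^ 2
      ≤ ∫⁻ Z in cell2 n L, ((kinetic2 n Θ Z +
            (periodicInteraction v L Z.1 + periodicInteraction v L Z.2) * ((‖Θ Z‖₊ : ℝ≥0∞)) ^ 2) +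
          (∑ j : Fin n, (2 : ℝ≥0∞)⁻¹ * (periodizedPotential v L (Z.2 0 - Z.1 j.succ) +
            periodizedPotential v L (Z.1 0 - Z.2 j.succ))) * ((‖Θ Z‖₊ : ℝ≥0∞)) ^ 2) := by
        refine lintegral_mono fun Z => ?_
        rw [add_assoc, ← add_mul]
        gcongr
        exact halfSwapWeight_le v L Z
    _ = _ := lintegral_add_right _
        ((measurable_crossWeight hv n L).fun_mul (hΘ.measurable.nnnorm.coe_nnreal_ennreal.pow_const _))

/-! #### Translation averaging -/

/-- **Shift of the second copy.** For a measurable weight `W` periodic in the second copy and any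
translation `T` of `(ℝ³)^N`,
`∫_{cell²} W(X, Y) |Ψ X|² |Ψ(Y - T)|² = ∫_{cell²} W(X, Y + T) |Ψ X|² |Ψ Y|²`
(Tonelli, then the `Y`-cell integral of a periodic integrand is translation invariant,
`lintegral_cellN_comp_add`). [folklore] -/
theorem lintegral_shift_snd (hL : 0 < L) (Ψ : PeriodicTrialState N L) {W : Config N × Config N → ℝ≥0∞}
    (hW : Measurable W)
    (hWper : ∀ (X Y : Config N) (i : Fin N) (k : Fin 3),
      W (X, Y + Pi.single i (EuclideanSpace.single k L)) = W (X, Y))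
    (T : Config N) :
    ∫⁻ Z in cellN N L ×ˢ cellN N L,
        W Z * (((‖Ψ.ψ Z.1‖₊ : ℝ≥0∞)) ^ 2 * ((‖Ψ.ψ (Z.2 - T)‖₊ : ℝ≥0∞)) ^ 2) =
      ∫⁻ Z in cellN N L ×ˢ cellN N L,
        W (Z.1, Z.2 + T) * (((‖Ψ.ψ Z.1‖₊ : ℝ≥0∞)) ^ 2 * ((‖Ψ.ψ Z.2‖₊ : ℝ≥0∞)) ^ 2) := by
  have hn : Measurable fun X : Config N => ((‖Ψ.ψ X‖₊ : ℝ≥0∞)) ^ 2 :=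
    measurable_normSq Ψ.contDiff.continuous
  have hl : Measurable fun Z : Config N × Config N =>
      W Z * (((‖Ψ.ψ Z.1‖₊ : ℝ≥0∞)) ^ 2 * ((‖Ψ.ψ (Z.2 - T)‖₊ : ℝ≥0∞)) ^ 2) :=
    hW.mul ((hn.comp measurable_fst).mul (hn.comp (measurable_snd.sub_const T)))
  have hr : Measurable fun Z : Config N × Config N =>
      W (Z.1, Z.2 + T) * (((‖Ψ.ψ Z.1‖₊ : ℝ≥0∞)) ^ 2 * ((‖Ψ.ψ Z.2‖₊ : ℝ≥0∞)) ^ 2) :=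
    (hW.comp (measurable_fst.prodMk (measurable_snd.add_const T))).mul
      ((hn.comp measurable_fst).mul (hn.comp measurable_snd))
  rw [ProductLower.volume_restrict_cellN_prod, lintegral_prod _ hl.aemeasurable,
    lintegral_prod _ hr.aemeasurable]
  refine lintegral_congr fun X => ?_
  dsimp only
  set G : Config N → ℝ≥0∞ := fun Y =>
    W (X, Y) * (((‖Ψ.ψ X‖₊ : ℝ≥0∞)) ^ 2 * ((‖Ψ.ψ (Y - T)‖₊ : ℝ≥0∞)) ^ 2) with hG_def
  have hG : ∀ (Y : Config N) (i : Fin N) (k : Fin 3),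
      G (Y + Pi.single i (EuclideanSpace.single k L)) = G Y := fun Y i k => by
    simp only [hG_def, hWper, add_sub_right_comm, Ψ.periodic]
  calc ∫⁻ Y in cellN N L, G Y = ∫⁻ Y in cellN N L, G (Y + T) := (lintegral_cellN_comp_add hL hG T).symm
    _ = _ := lintegral_congr fun Y => by simp only [hG_def, add_sub_cancel_right]

/-- One tagged cross pair, averaged over the translation:
`∫_{[0,L)³} ½ (v^per(a + t - b) + v^per(c - (d + t))) dt = ∫_{ℝ³} v(|y|) dy`
(`∫_{[0,L)³} v^per(· - x) = ∫_{ℝ³} v`, `lintegral_cell_periodizedPotential_sub`; `v^per` is even). [folklore] -/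
theorem lintegral_cell_crossPair (hL : 0 < L) {v : ℝ → ℝ≥0∞} (hv : Measurable v) (a b c d : Space) :
    ∫⁻ t in cell L, (2 : ℝ≥0∞)⁻¹ * (periodizedPotential v L (a + t - b) +
        periodizedPotential v L (c - (d + t))) = ∫⁻ y : Space, v ‖y‖ := by
  have e1 : ∀ t : Space, a + t - b = t - (b - a) := fun t => by abel
  have e2 : ∀ t : Space, c - (d + t) = -(t - (c - d)) := fun t => by abel
  simp_rw [e1, e2, periodizedPotential_neg]
  have h1 : Measurable fun t : Space => periodizedPotential v L (t - (b - a)) :=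
    (measurable_periodizedPotential hv L).comp (measurable_id.sub_const _)
  have h2 : Measurable fun t : Space => periodizedPotential v L (t - (c - d)) :=
    (measurable_periodizedPotential hv L).comp (measurable_id.sub_const _)
  have h12 : Measurable fun t : Space => periodizedPotential v L (t - (b - a)) +
      periodizedPotential v L (t - (c - d)) := h1.add h2
  rw [lintegral_const_mul _ h12, lintegral_add_left h1, lintegral_cell_periodizedPotential_sub hL hv,
    lintegral_cell_periodizedPotential_sub hL hv, mul_add, LowerFrame.inv_two_mul_add_self]

/-- **The translation average of the shifted cross weight**:
`∫_{[0,L)³} ∑ⱼ ½ (v^per(y₀ + t - xⱼ₊₁) + v^per(x₀ - (yⱼ₊₁ + t))) dt = n · ∫_{ℝ³} v(|y|) dy`. [folklore] -/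
theorem lintegral_cell_crossWeight_shift (hL : 0 < L) {v : ℝ → ℝ≥0∞} (hv : Measurable v)
    (Z : Config (n + 1) × Config (n + 1)) :
    ∫⁻ t in cell L, ∑ j : Fin n, (2 : ℝ≥0∞)⁻¹ *
        (periodizedPotential v L ((Z.2 + fun _ => t : Config (n + 1)) 0 - Z.1 j.succ) +
          periodizedPotential v L (Z.1 0 - (Z.2 + fun _ => t : Config (n + 1)) j.succ)) =
      (n : ℝ≥0∞) * ∫⁻ y : Space, v ‖y‖ := by
  simp only [Pi.add_apply]
  have hm : ∀ j : Fin n, Measurable fun t : Space => (2 : ℝ≥0∞)⁻¹ *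
      (periodizedPotential v L (Z.2 0 + t - Z.1 j.succ) + periodizedPotential v L (Z.1 0 - (Z.2 j.succ + t))) :=
    fun j => (((measurable_periodizedPotential hv L).comp ((measurable_const_add _).sub_const _)).add
      ((measurable_periodizedPotential hv L).comp ((measurable_const_add _).const_sub _))).const_mul _
  rw [lintegral_finsetSum _ fun j _ => hm j]
  simp only [lintegral_cell_crossPair hL hv]
  rw [Finset.sum_const, Finset.card_univ, Fintype.card_fin, nsmul_eq_mul]

/-- The cross weight is `Lℤ³`-periodic in every particle of the second copy. [folklore] -/
theorem crossWeight_add_single (v : ℝ → ℝ≥0∞) (L : ℝ) (X Y : Config (n + 1)) (i : Fin (n + 1))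
    (k : Fin 3) :
    (∑ j : Fin n, (2 : ℝ≥0∞)⁻¹ *
        (periodizedPotential v L ((Y + Pi.single i (EuclideanSpace.single k L) : Config (n + 1)) 0 - X j.succ) +
          periodizedPotential v L
            (X 0 - (Y + Pi.single i (EuclideanSpace.single k L) : Config (n + 1)) j.succ))) =
      ∑ j : Fin n, (2 : ℝ≥0∞)⁻¹ *
        (periodizedPotential v L (Y 0 - X j.succ) + periodizedPotential v L (X 0 - Y j.succ)) := by
  refine Finset.sum_congr rfl fun j _ => ?_
  obtain ⟨m, hm⟩ := exists_apply_add_single Y i k L 0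
  obtain ⟨m', hm'⟩ := exists_apply_add_single Y i k L j.succ
  rw [hm, hm', add_sub_right_comm, periodizedPotential_add_latticeVec, ← sub_sub,
    periodizedPotential_sub_latticeVec]

/-- **Averaging over translations of the second copy** (abstract weight): if `W` is measurable,
periodic in the second copy, and the translation average of its shift `t ↦ W(X, Y + t𝟙)` over `[0,L)³`
is the constant `C`, then `∫_{[0,L)³} ∫_{cell²} W(X, Y) |Ψ X · Ψ(Y - t𝟙)|² dt = C` (shift of the second
copy, Tonelli, `∫|Ψ|² = 1` twice). [folklore] -/
theorem lintegral_cell_translate_eq (hL : 0 < L) (Ψ : PeriodicTrialState N L)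
    {W : Config N × Config N → ℝ≥0∞} (hW : Measurable W)
    (hWper : ∀ (X Y : Config N) (i : Fin N) (k : Fin 3),
      W (X, Y + Pi.single i (EuclideanSpace.single k L)) = W (X, Y))
    {C : ℝ≥0∞} (hC : ∀ Z : Config N × Config N, ∫⁻ t in cell L, W (Z.1, Z.2 + fun _ => t) = C) :
    ∫⁻ t in cell L, ∫⁻ Z in cellN N L ×ˢ cellN N L,
        W Z * ((‖Ψ.ψ Z.1 * Ψ.ψ (Z.2 - fun _ => t)‖₊ : ℝ≥0∞)) ^ 2 = C := by
  -- short-cut the `SFinite volume` instance searches on `(ℝ³)^N`, `(ℝ³)^N × (ℝ³)^N` and `ℝ³`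
  haveI : SFinite (volume : Measure (Config N)) := instSFiniteOfSigmaFinite
  haveI : SFinite (volume : Measure Space) := instSFiniteOfSigmaFinite
  have hn : Measurable fun X : Config N => ((‖Ψ.ψ X‖₊ : ℝ≥0∞)) ^ 2 :=
    measurable_normSq Ψ.contDiff.continuous
  have hρ : Measurable fun Z : Config N × Config N =>
      ((‖Ψ.ψ Z.1‖₊ : ℝ≥0∞)) ^ 2 * ((‖Ψ.ψ Z.2‖₊ : ℝ≥0∞)) ^ 2 :=
    (hn.comp measurable_fst).mul (hn.comp measurable_snd)
  -- joint measurability of the shifted weight `(t, Z) ↦ W (Z.1, Z.2 + t𝟙)`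
  have hsh : Measurable fun p : Space × (Config N × Config N) => W (p.2.1, p.2.2 + fun _ => p.1) :=
    hW.comp (continuous_snd.fst.prodMk
      (continuous_snd.snd.add (continuous_pi fun _ => continuous_fst))).measurable
  have hF : AEMeasurable (Function.uncurry fun (t : Space) (Z : Config N × Config N) =>
      W (Z.1, Z.2 + fun _ => t) * (((‖Ψ.ψ Z.1‖₊ : ℝ≥0∞)) ^ 2 * ((‖Ψ.ψ Z.2‖₊ : ℝ≥0∞)) ^ 2))
      (((volume : Measure Space).restrict (cell L)).prod
        ((volume : Measure (Config N × Config N)).restrict (cellN N L ×ˢ cellN N L))) :=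
    (hsh.mul (hρ.comp measurable_snd)).aemeasurable
  calc ∫⁻ t in cell L, ∫⁻ Z in cellN N L ×ˢ cellN N L,
          W Z * ((‖Ψ.ψ Z.1 * Ψ.ψ (Z.2 - fun _ => t)‖₊ : ℝ≥0∞)) ^ 2
      = ∫⁻ t in cell L, ∫⁻ Z in cellN N L ×ˢ cellN N L,
          W (Z.1, Z.2 + fun _ => t) * (((‖Ψ.ψ Z.1‖₊ : ℝ≥0∞)) ^ 2 * ((‖Ψ.ψ Z.2‖₊ : ℝ≥0∞)) ^ 2) := by
        refine lintegral_congr fun t => ?_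
        simp_rw [ennnorm_mul_sq]
        exact lintegral_shift_snd hL Ψ hW hWper fun _ => t
    _ = ∫⁻ Z in cellN N L ×ˢ cellN N L, ∫⁻ t in cell L,
          W (Z.1, Z.2 + fun _ => t) * (((‖Ψ.ψ Z.1‖₊ : ℝ≥0∞)) ^ 2 * ((‖Ψ.ψ Z.2‖₊ : ℝ≥0∞)) ^ 2) :=
        lintegral_lintegral_swap hF
    _ = ∫⁻ Z in cellN N L ×ˢ cellN N L,
          C * (((‖Ψ.ψ Z.1‖₊ : ℝ≥0∞)) ^ 2 * ((‖Ψ.ψ Z.2‖₊ : ℝ≥0∞)) ^ 2) := by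
        refine lintegral_congr fun Z => ?_
        have hm : Measurable fun t : Space => W (Z.1, Z.2 + fun _ => t) :=
          hsh.comp (measurable_id.prodMk measurable_const)
        rw [lintegral_mul_const _ hm, hC Z]
    _ = C := by rw [lintegral_const_mul C hρ, lintegral_normSq_mul_normSq Ψ Ψ, mul_one]

/-- **The translation average of the cross terms is first-order perturbation theory**:
`∫_{[0,L)³} Cross(t) dt = n · ∫_{ℝ³} v(|y|) dy`, where
`Cross(t) = ∫_{cell²} (∑ⱼ ½ (v^per(y₀ - xⱼ₊₁) + v^per(x₀ - yⱼ₊₁))) |Ψ X · Ψ(Y - t𝟙)|²`. [folklore] -/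
theorem lintegral_cell_cross (hL : 0 < L) {v : ℝ → ℝ≥0∞} (hv : Measurable v)
    (Ψ : PeriodicTrialState (n + 1) L) :
    ∫⁻ t in cell L, ∫⁻ Z in cell2 n L,
        (∑ j : Fin n, (2 : ℝ≥0∞)⁻¹ * (periodizedPotential v L (Z.2 0 - Z.1 j.succ) +
          periodizedPotential v L (Z.1 0 - Z.2 j.succ))) *
          ((‖Ψ.ψ Z.1 * Ψ.ψ (Z.2 - fun _ => t)‖₊ : ℝ≥0∞)) ^ 2 =
      (n : ℝ≥0∞) * ∫⁻ y : Space, v ‖y‖ := by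
  have h := lintegral_cell_translate_eq hL Ψ (measurable_crossWeight hv n L)
    (fun X Y i k => crossWeight_add_single v L X Y i k) (C := (n : ℝ≥0∞) * ∫⁻ y : Space, v ‖y‖)
    (fun Z => lintegral_cell_crossWeight_shift hL hv Z)
  exact h

/-! #### The bound for a fixed trial state and a fixed translation -/

/-- **Pointwise in the translation**: for every periodic trial state `Ψ` and every `t ∈ ℝ³`,
`inf_{Adm0} E2(½) ≤ 2 · periodicEnergy v Ψ + Cross(t)`, testing the infimum with `Ψ ⊗ Ψ(· - t𝟙)`
(absolutely admissible, uncoupled energy `2 · periodicEnergy v Ψ` by translation invariance of the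
torus Hamiltonian, `periodicEnergy_translate`). [folklore] -/
theorem iInf_le_of_translate {v : ℝ → ℝ≥0∞} (hv : IsRepulsiveFiniteRange v)
    (Ψ : PeriodicTrialState (n + 1) L) (t : Space) :
    (⨅ (Θ : Config (n + 1) × Config (n + 1) → ℂ) (_ : Adm0 n L Θ), E2half v n L Θ) ≤
      2 * periodicEnergy v Ψ + ∫⁻ Z in cell2 n L,
        (∑ j : Fin n, (2 : ℝ≥0∞)⁻¹ * (periodizedPotential v L (Z.2 0 - Z.1 j.succ) +
          periodizedPotential v L (Z.1 0 - Z.2 j.succ))) *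
          ((‖Ψ.ψ Z.1 * Ψ.ψ (Z.2 - fun _ => t)‖₊ : ℝ≥0∞)) ^ 2 := by
  obtain ⟨Φ, hΦ⟩ := Ψ.exists_translate t
  have hAdm : Adm0 n L fun Z => Ψ.ψ Z.1 * Φ.ψ Z.2 :=
    ⟨contDiff_prod₂ Ψ Φ, fun Z i k => periodic_prod₂ Ψ Φ Z i k, by
      simp_rw [TwoCopyTorus.cell2, ennnorm_mul_sq]; exact lintegral_normSq_mul_normSq Ψ Φ⟩
  have hzero : E2zero v n L (fun Z => Ψ.ψ Z.1 * Φ.ψ Z.2) = 2 * periodicEnergy v Ψ := by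
    have h := energy_prod₂_eq hv.1 Ψ Φ
    rw [periodicEnergy_translate v Ψ t hΦ, ← two_mul] at h
    exact h
  refine (iInf₂_le _ hAdm).trans
    ((E2half_le_E2zero_add hv.1 L (contDiff_prod₂ Ψ Φ).continuous).trans_eq ?_)
  rw [hzero, hΦ]

end UpperFrameIntegrable

/-! ### The registered stub -/

/-- S6b — **the half-swap defect costs at most first-order perturbation theory, uniformly in `n`**
(upper frame): for every repulsive finite-range `v`, every `n` and every `L > 0`,
`inf_{Adm0} E2(½) ≤ 2 · E₀^per(n+1, L) + n · L⁻³ · ∫_{ℝ³} v(|x|) dx` — translation averaging of the product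
of a trial state with its translate (`stub_upperFrameIntegrable`, registered signature). [folklore] -/
theorem stub_upperFrameIntegrable :
    ∀ v : ℝ → ℝ≥0∞, IsRepulsiveFiniteRange v → ∀ (n : ℕ) (L : ℝ), 0 < L →
      (⨅ (Θ : Config (n + 1) × Config (n + 1) → ℂ) (_ : TwoCopyTorus.Adm0 n L Θ), TwoCopyTorus.E2half v n L Θ) ≤
        2 * periodicGroundStateEnergy v (n + 1) L + (n : ℝ≥0∞) * (ENNReal.ofReal (L ^ 3))⁻¹ * ∫⁻ x : Space, v ‖x‖ := by
  intro v hv n L hL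
  set J := (⨅ (Θ : Config (n + 1) × Config (n + 1) → ℂ) (_ : TwoCopyTorus.Adm0 n L Θ),
    TwoCopyTorus.E2half v n L Θ) with hJ
  -- it suffices to bound `J` by `2 · periodicEnergy v Ψ + n L⁻³ ∫ v` for every trial state `Ψ`
  suffices h : ∀ Ψ : PeriodicTrialState (n + 1) L,
      J ≤ 2 * periodicEnergy v Ψ + (n : ℝ≥0∞) * (ENNReal.ofReal (L ^ 3))⁻¹ * ∫⁻ x : Space, v ‖x‖ by
    refine (le_iInf h).trans_eq ?_
    rw [periodicGroundStateEnergy, ENNReal.mul_iInf_of_ne two_ne_zero ENNReal.ofNat_ne_top, ENNReal.iInf_add]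
  intro Ψ
  -- the cell `[0,L)³` has volume `L³ ∈ (0, ∞)`
  have hV : volume (cell L) = ENNReal.ofReal (L ^ 3) := by rw [volume_cell, ENNReal.ofReal_pow hL.le]
  have hV0 : ENNReal.ofReal (L ^ 3) ≠ 0 := (ENNReal.ofReal_pos.2 (by positivity)).ne'
  have hVt : ENNReal.ofReal (L ^ 3) ≠ ⊤ := ENNReal.ofReal_ne_top
  -- integrate the pointwise-in-`t` bound over `t ∈ [0,L)³`
  have key : J * ENNReal.ofReal (L ^ 3) ≤
      2 * periodicEnergy v Ψ * ENNReal.ofReal (L ^ 3) + (n : ℝ≥0∞) * ∫⁻ x : Space, v ‖x‖ := by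
    calc J * ENNReal.ofReal (L ^ 3) = ∫⁻ _ in cell L, J := by rw [setLIntegral_const, hV]
      _ ≤ ∫⁻ t in cell L, (2 * periodicEnergy v Ψ + ∫⁻ Z in TwoCopyTorus.cell2 n L,
            (∑ j : Fin n, (2 : ℝ≥0∞)⁻¹ * (periodizedPotential v L (Z.2 0 - Z.1 j.succ) +
              periodizedPotential v L (Z.1 0 - Z.2 j.succ))) *
              ((‖Ψ.ψ Z.1 * Ψ.ψ (Z.2 - fun _ => t)‖₊ : ℝ≥0∞)) ^ 2) :=
          lintegral_mono fun t => UpperFrameIntegrable.iInf_le_of_translate hv Ψ t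
      _ = 2 * periodicEnergy v Ψ * ENNReal.ofReal (L ^ 3) + (n : ℝ≥0∞) * ∫⁻ x : Space, v ‖x‖ := by
          rw [lintegral_add_left measurable_const, setLIntegral_const, hV,
            UpperFrameIntegrable.lintegral_cell_cross hL hv.1 Ψ]
  -- divide by `L³`
  calc J = J * ENNReal.ofReal (L ^ 3) * (ENNReal.ofReal (L ^ 3))⁻¹ := (ENNReal.mul_inv_cancel_right hV0 hVt).symm
    _ ≤ (2 * periodicEnergy v Ψ * ENNReal.ofReal (L ^ 3) + (n : ℝ≥0∞) * ∫⁻ x : Space, v ‖x‖) *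
          (ENNReal.ofReal (L ^ 3))⁻¹ := by
        gcongr
    _ = 2 * periodicEnergy v Ψ + (n : ℝ≥0∞) * (ENNReal.ofReal (L ^ 3))⁻¹ * ∫⁻ x : Space, v ‖x‖ := by
        rw [add_mul, ENNReal.mul_inv_cancel_right hV0 hVt, mul_right_comm]

end Summit.AtomisticToContinuum.BoseEinsteinCondensation.Cruxes.TorusHalfSwapOverlap.Birth

end
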